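import Literature.AlgebraicGeometry.Resolution.StrictTransformFlatteningReduction
import Literature.AlgebraicGeometry.Resolution.StrictTransformBaseLocality
import Literature.AlgebraicGeometry.Resolution.SeparatingBlowup
import HarnessLib

/-!
# Raynaud–Gruson flattening by admissible blowing ups (Stacks 081R): reduction to an affine
# base

Topic: `Literature/AlgebraicGeometry/Resolution`. The named fact `Stacks081R`
(`StrictTransformFlattening.lean`; Raynaud–Gruson 1971, Première partie, Thm. 5.2.2, in the form
of the Stacks Project, Tag 081R = More on Flatness, Lemma 38.31.1) asks, for `S` quasi-compact
and quasi-separated, `U ⊆ S` a quasi-compact open and `f : X → S` of finite type and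
quasi-separated with `X_U → U` flat and locally of finite presentation, for a `U`-admissible
blowing up `S' → S` such that the strict transform of `X` is flat and locally of finite
presentation over `S'`. The printed proof (through More on Flatness, Theorem 38.30.7 = Tag 0815
and its Lemma 38.30.6 = Tag 0814, "the question is étale local on `S`") begins by localising on
the base. This file PROVES the Zariski part of that localisation, in the pointwise form needed to
assemble local flattenings:

* `exists_isBlowup_flat_lfp_of_forall_affineOpens_base` — **if over every affine open `T ⊆ S`
  the base change `X_T → T` admits a `(U ∩ T)`-admissible blowing up flattening its strict
  transform, then `X → S` admits a `U`-admissible blowing up flattening its strict transform**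
  (`S` quasi-compact and quasi-separated, `U` quasi-compact);
* `exists_isBlowup_flat_lfp_of_forall_affineOpens_source` — the same with respect to a cover of
  the *source* by affine opens (the pointwise form of `stacks081R_of_affine`,
  `StrictTransformFlatteningReduction.lean`);
* `stacks081R_of_isAffine_base`, `stacks081R_of_isAffine_isAffine` — **`Stacks081R` follows
  from its special case of an affine base, resp. of an affine base and an affine source.**

Proof of the base reduction, as printed for the source (Stacks, proof of 081R, ¶1) and for the
base in Tag 0814: choose a finite affine open cover `S = ⋃ Tₖ` and `(U ∩ Tₖ)`-admissible blowing
ups `bₖ : Tₖ' → Tₖ` in ideal sheaves `𝓘ₖ` of finite type on `Tₖ` flattening the strict transforms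
of `X_{Tₖ} → Tₖ`. Each `𝓘ₖ` extends to an ideal sheaf `𝓖ₖ` of finite type on `S` with
`𝓖ₖ|_{Tₖ} = 𝓘ₖ` and `V(𝓖ₖ) ∩ U = ∅` (extend `𝓘ₖ` by the unit ideal over `U`, then from the
quasi-compact open `Tₖ ∪ U` to `S` by Stacks 01PF, `exists_fg_le_ideal_eq`). The blowing up
`c : S' → S` in `∏ₖ 𝓖ₖ` is `U`-admissible; over `Tₖ` it is a blowing up of `Tₖ` in
`𝓘ₖ · (∏_{j ≠ k} 𝓖ⱼ)|_{Tₖ}`, hence (Stacks 080A/080N: `IsBlowup.comp`, uniqueness of blowing ups)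
factors through `bₖ`; by persistence of flat strict transforms under such dominations
(`flat_blowupStrictTransformMap_of_dominating`, `StrictTransformPersistence.lean`) the strict
transform of `X_{Tₖ}` along `c|_{Tₖ}` is flat and locally of finite presentation, and these are
the pieces of the strict transform of `X` over the open cover `(c⁻¹Tₖ)` of `S'`
(`blowupStrictTransformMap_of_openCover_base`, `StrictTransformBaseLocality.lean`).

What remains of `Stacks081R` after `stacks081R_of_isAffine_isAffine` is the case `S = Spec R`,
`X = Spec A` with `A` an `R`-algebra of finite type — the setting of the induction of
Raynaud–Gruson, Première partie, §5 (Stacks, Tag 0815).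

## References

* The Stacks Project, Tag 081R (More on Flatness, Lemma 38.31.1) and its proof; Tag 0814
  (Lemma 38.30.6: the statement is local on the base); Tag 080N; Tag 01PF. [StacksProject]
* M. Raynaud, L. Gruson, *Critères de platitude et de projectivité. Techniques de
  «platification» d'un module*, Invent. Math. 13 (1971) 1–89, Première partie, Thm. 5.2.2.
  [RaynaudGruson1971]
-/

noncomputable section

open CategoryTheory CategoryTheory.Limits AlgebraicGeometry TopologicalSpace

namespace Literature.AlgebraicGeometry.Resolution

universe u

open Literature.AlgebraicGeometry.Limits

/-! ## Restricting a base change over an open of the base -/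

/-- **A property stable under base change passes from `f|_U : X_U → U` to
`(X ×_S S₀)|_{i⁻¹U} → i⁻¹U`** for `i : S₀ → S`: the latter is the base change of the former
along `i|_U : i⁻¹U → U` (the same statement as `morphismRestrict_pullback_snd_of_morphismRestrict`
of `BaseChangeOverOpens.lean`, repeated here to keep this file below the `Alterations` files in
the import graph). [folklore] -/
theorem pullback_snd_morphismRestrict_preimage (P : MorphismProperty Scheme.{u})
    [P.IsStableUnderBaseChange] {X S S₀ : Scheme.{u}} (f : X ⟶ S) (i : S₀ ⟶ S) (U : S.Opens)
    (hP : P (f ∣_ U)) : P ((pullback.snd f i) ∣_ (i ⁻¹ᵁ U)) := by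
  -- `(X ×_S S₀)|_{i⁻¹U} → X` over `i⁻¹U → S₀ → S` is cartesian
  have outer : IsPullback (((pullback.snd f i) ⁻¹ᵁ (i ⁻¹ᵁ U)).ι ≫ pullback.fst f i)
      ((pullback.snd f i) ∣_ (i ⁻¹ᵁ U)) f ((i ⁻¹ᵁ U).ι ≫ i) :=
    (isPullback_morphismRestrict (pullback.snd f i) (i ⁻¹ᵁ U)).flip.paste_horiz
      (IsPullback.of_hasPullback f i)
  rw [← morphismRestrict_ι] at outer
  -- cancel the cartesian square of `f|_U`
  exact P.of_isPullback (IsPullback.of_right' outer (isPullback_morphismRestrict f U).flip) hP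

/-! ## Extending an admissible centre from an open of the base -/

/-- **Extension of an admissible centre.** Let `S` be quasi-compact and quasi-separated,
`U, T ⊆ S` quasi-compact opens and `𝓘` an ideal sheaf of finite type on `T` whose support does
not meet `U ∩ T`. Then there is an ideal sheaf `𝓖` of finite type on `S` with `𝓖|_T = 𝓘` whose
support does not meet `U`: the ideal sheaf `(T ↪ S)_*𝓘 ∩ 𝒪_S` restricts to `𝓘` on `T` and to
the unit ideal on `U`, so is of finite type on the quasi-compact open `T ∪ U`, and Stacks 01PF
(`exists_fg_le_ideal_eq`) extends its restriction to an ideal sheaf of finite type on `S`.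
[cite: StacksProject, Tag 080N (proof) with Tag 01PF] -/
theorem exists_fg_comap_ι_eq_of_disjoint {S : Scheme.{u}} [CompactSpace S] [QuasiSeparatedSpace S]
    (U : S.Opens) (hU : IsCompact (U : Set S)) (T : S.Opens) (hT : IsCompact (T : Set S))
    (I : (T : Scheme.{u}).IdealSheafData)
    (hIfg : ∀ W : (T : Scheme.{u}).affineOpens, (I.ideal W).FG)
    (hIU : Disjoint ((T.ι ⁻¹ᵁ U : (T : Scheme.{u}).Opens) : Set T) (I.support : Set T)) :
    ∃ G : S.IdealSheafData, (∀ W : S.affineOpens, (G.ideal W).FG) ∧ G.comap T.ι = I ∧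
      Disjoint (U : Set S) (G.support : Set S) := by
  haveI : QuasiCompact T.ι := quasiCompact_ι_of_isCompact T hT
  -- `H = (T ↪ S)_* 𝓘 ∩ 𝒪_S` restricts to `𝓘` on `T` …
  have e : (I.map T.ι).comap T.ι = I := comap_map_of_isOpenImmersion T.ι I
  -- … and its support does not meet `U`
  have hHU : Disjoint (U : Set S) ((I.map T.ι).support : Set S) := by
    rw [Scheme.IdealSheafData.support_map, Closeds.coe_closure]
    refine Disjoint.closure_right ?_ U.2
    refine Set.disjoint_left.mpr fun x hxU hx => ?_
    obtain ⟨y, hy, rfl⟩ := hx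
    exact Set.disjoint_left.mp hIU (show T.ι y ∈ U from hxU) hy
  have hHtop : ∀ W : S.affineOpens, (W : S.Opens) ≤ U → (I.map T.ι).ideal W = ⊤ := fun W hW =>
    ideal_eq_top_of_le_centreCompl _ W fun x hx hx' => Set.disjoint_left.mp hHU (hW hx) hx'
  -- so `H` is of finite type on `T ∪ U`
  have hV : IsCompact (((T ⊔ U : S.Opens)) : Set S) := by
    rw [Opens.coe_sup]
    exact hT.union hU
  have hHfg : ∀ W : S.affineOpens, (W : S.Opens) ≤ T ⊔ U → ((I.map T.ι).ideal W).FG := by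
    intro W hW
    refine fg_ideal_of_le_iSup _ (fun b : Bool => cond b T U) (fun b W' hW' => ?_) W
      (by rwa [iSup_bool_eq])
    cases b with
    | true =>
      exact fg_ideal_of_fg_ideal_comap_ι (U := T) (fun W'' => by rw [e]; exact hIfg W'') W' hW'
    | false =>
      rw [hHtop W' hW']
      exact ⟨{1}, by simp⟩
  -- extend from `T ∪ U` to `S` (Stacks 01PF)
  obtain ⟨G, hGfg, -, hGeq⟩ := exists_fg_le_ideal_eq (T ⊔ U) hV ⊤ (I.map T.ι) hHfg
    (fun W _ => by rw [Scheme.IdealSheafData.ideal_top]; exact le_top)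
  refine ⟨G, hGfg, ?_, ?_⟩
  · rw [← e]
    exact comap_ι_eq_of_forall_ideal_eq fun W hW => hGeq W (hW.trans le_sup_left)
  · refine Set.disjoint_left.mpr fun x hxU hxG => ?_
    obtain ⟨W, hW, hxW, hWU⟩ :=
      exists_isAffineOpen_mem_and_subset (X := S) (x := x) (U := U) hxU
    have hGW : G.ideal ⟨W, hW⟩ = ⊤ :=
      (hGeq ⟨W, hW⟩ (hWU.trans le_sup_right)).trans (hHtop ⟨W, hW⟩ hWU)
    have hxG' : x ∈ G.support := hxG
    rw [Scheme.IdealSheafData.mem_support_iff_of_mem (I := G) (U := ⟨W, hW⟩) hxW, hGW,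
      Scheme.mem_zeroLocus_iff] at hxG'
    exact hxG' 1 Submodule.mem_top (by rw [Scheme.basicOpen_one]; exact hxW)

/-! ## The conclusion of Stacks 081R is local on the base -/

/-- **The conclusion of `Stacks081R` is Zariski-local on the base.** Let `S` be quasi-compact
and quasi-separated, `U ⊆ S` a quasi-compact open and `f : X → S` any morphism. Suppose that for
every affine open `T ⊆ S` there are an ideal sheaf `𝓘_T` of finite type on `T` with support
disjoint from `U ∩ T` and a blowing up `b_T : T' → T` of `T` in `𝓘_T` such that the strict
transform of `X ×_S T → T` along `b_T` is flat and locally of finite presentation. Then there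
are an ideal sheaf `𝓘` of finite type on `S` with support disjoint from `U` and a blowing up
`b : S' → S` in `𝓘` such that the strict transform of `X` along `b` is flat and locally of
finite presentation. (Finite affine cover; extension of the centres to `U`-admissible centres
on `S`; blowing up in their product, which dominates each `b_T` over `T`; persistence of flat
strict transforms; locality of the strict transform on the base.)
[cite: StacksProject, Tag 0814 with Tag 081R (proof) and Tag 080N] -/
theorem exists_isBlowup_flat_lfp_of_forall_affineOpens_base {X S : Scheme.{u}} (f : X ⟶ S)
    [CompactSpace S] [QuasiSeparatedSpace S] (U : S.Opens) (hU : IsCompact (U : Set S))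
    (h : ∀ T : S.affineOpens, ∃ (I : (T : Scheme.{u}).IdealSheafData) (T' : Scheme.{u})
      (b : T' ⟶ T),
      (∀ W : (T : Scheme.{u}).affineOpens, (I.ideal W).FG) ∧
      Disjoint (((T : S.Opens).ι ⁻¹ᵁ U : (T : Scheme.{u}).Opens) : Set T) (I.support : Set T) ∧
      IsBlowup b I ∧
      Flat (blowupStrictTransformMap (pullback.snd f (T : S.Opens).ι) b I) ∧
      LocallyOfFinitePresentation (blowupStrictTransformMap (pullback.snd f (T : S.Opens).ι) b I)) :
    ∃ (I : S.IdealSheafData) (S' : Scheme.{u}) (b : S' ⟶ S),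
      (∀ W : S.affineOpens, (I.ideal W).FG) ∧ Disjoint (U : Set S) (I.support : Set S) ∧
      IsBlowup b I ∧ Flat (blowupStrictTransformMap f b I) ∧
      LocallyOfFinitePresentation (blowupStrictTransformMap f b I) := by
  classical
  obtain ⟨t, ht⟩ := exists_finset_affineOpens_iSup_eq_top S
  have ht' : ⨆ T : t, (((T : S.affineOpens) : S.Opens)) = ⊤ :=
    top_le_iff.mp (ht.trans (le_of_eq iSup_subtype'))
  choose I S₁ b₁ hIfg hIU hb₁ hflat₁ hlfp₁ using h
  -- extend the centres `I T` to `U`-admissible centres `G T` on `S`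
  have hG : ∀ T : S.affineOpens, ∃ G : S.IdealSheafData, (∀ W : S.affineOpens, (G.ideal W).FG) ∧
      G.comap (T : S.Opens).ι = I T ∧ Disjoint (U : Set S) (G.support : Set S) := fun T =>
    exists_fg_comap_ι_eq_of_disjoint U hU (T : S.Opens) T.2.isCompact (I T) (hIfg T) (hIU T)
  choose G hGfg hGI hGU using hG
  -- blow up the product of the extended centres over a finite affine cover
  obtain ⟨S', c, hc⟩ := exists_isBlowup S (∏ T : t, G T)
  have hE : IsEffectiveCartier ((∏ T : t, G T).comap c) := hc.isEffectiveCartier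
  have hCfg : ∀ W : S.affineOpens, ((∏ T : t, G T).ideal W).FG :=
    fg_ideal_finsetProd _ _ fun T _ => hGfg T
  have hCU : Disjoint (U : Set S) ((∏ T : t, G T).support : Set S) := by
    rw [support_finsetProd]
    exact Set.disjoint_iUnion₂_right.mpr fun T _ => hGU T
  -- over each member of the cover, `c` dominates `b₁ T`, so the strict transform is flat there
  have hpiece : ∀ T : t,
      Flat (blowupStrictTransformMap (pullback.snd f ((T : S.affineOpens) : S.Opens).ι)
        (pullback.snd c ((T : S.affineOpens) : S.Opens).ι)
        ((∏ T' : t, G T').comap ((T : S.affineOpens) : S.Opens).ι)) ∧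
      LocallyOfFinitePresentation
        (blowupStrictTransformMap (pullback.snd f ((T : S.affineOpens) : S.Opens).ι)
          (pullback.snd c ((T : S.affineOpens) : S.Opens).ι)
          ((∏ T' : t, G T').comap ((T : S.affineOpens) : S.Opens).ι)) := by
    intro T
    have hrest : (∏ T' : t, G T').comap ((T : S.affineOpens) : S.Opens).ι =
        I T * (∏ T' ∈ Finset.univ.erase T, G T').comap ((T : S.affineOpens) : S.Opens).ι := by
      rw [← Finset.mul_prod_erase Finset.univ (fun T' : t => G T') (Finset.mem_univ T), comap_mul,
        hGI]
    -- `c` restricted over `T` is a blowing up of `T` in the restricted centre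
    have hcT : IsBlowup (pullback.snd c ((T : S.affineOpens) : S.Opens).ι)
        ((∏ T' : t, G T').comap ((T : S.affineOpens) : S.Opens).ι) := by
      rw [← pullbackRestrictIsoRestrict_hom_morphismRestrict]
      exact (hc.restrict _).iso_comp (pullbackRestrictIsoRestrict c _)
    -- and so is `Bl_{b₁⁻¹(∏_{T' ≠ T} 𝓖_{T'})} (S₁ T) → S₁ T → T`; hence `c` factors through `b₁ T`
    obtain ⟨Z, c', hc'⟩ := exists_isBlowup (S₁ T)
      (((∏ T' ∈ Finset.univ.erase T, G T').comap ((T : S.affineOpens) : S.Opens).ι).comap (b₁ T))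
    have hcomp : IsBlowup (c' ≫ b₁ T) ((∏ T' : t, G T').comap ((T : S.affineOpens) : S.Opens).ι) := by
      rw [hrest]
      exact (hb₁ T).comp hc'
    obtain ⟨e, he, -⟩ := hcT.unique hcomp
    have hcomm : (e.hom ≫ c') ≫ b₁ T = pullback.snd c ((T : S.affineOpens) : S.Opens).ι := by
      rw [Category.assoc, he]
    have hsupp : ((I T).support : Set (T : S.affineOpens)) ⊆
        ((∏ T' : t, G T').comap ((T : S.affineOpens) : S.Opens).ι).support := by
      refine Scheme.IdealSheafData.support_antitone ?_
      rw [← hGI T]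
      exact Scheme.IdealSheafData.comap_mono _
        (finsetProd_le Finset.univ (fun T' : t => G T') (Finset.mem_univ T))
    haveI := hflat₁ T
    haveI := hlfp₁ T
    exact ⟨flat_blowupStrictTransformMap_of_dominating (Iᵢ := I T) (I := _) hcomm hsupp
        hcT.isEffectiveCartier,
      locallyOfFinitePresentation_blowupStrictTransformMap_of_dominating (Iᵢ := I T) (I := _)
        hcomm hsupp hcT.isEffectiveCartier⟩
  refine ⟨∏ T : t, G T, S', c, hCfg, hCU, hc, ?_, ?_⟩
  · exact blowupStrictTransformMap_of_openCover_base f c _ @Flat hE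
      (S.openCoverOfIsOpenCover (fun T : t => ((T : S.affineOpens) : S.Opens)) ht')
      fun T => (hpiece T).1
  · exact blowupStrictTransformMap_of_openCover_base f c _ @LocallyOfFinitePresentation hE
      (S.openCoverOfIsOpenCover (fun T : t => ((T : S.affineOpens) : S.Opens)) ht')
      fun T => (hpiece T).2

/-! ## The conclusion of Stacks 081R is local on the source (pointwise form) -/

/-- **The conclusion of `Stacks081R` is local on the source** (pointwise form of
`stacks081R_of_affine`): for `X` quasi-compact, if for every affine open `V ⊆ X` there is a
`U`-admissible blowing up of `S` in an ideal sheaf of finite type flattening the strict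
transform of `V → S`, then there is one flattening the strict transform of `X → S`. Proof as
printed (Stacks, proof of 081R, ¶1): finite affine cover, one `U`-admissible blowing up
dominating the finitely many given ones (Tag 080N), persistence of flat strict transforms, and
locality of the strict transform on the source. [cite: StacksProject, Tag 081R (proof)] -/
theorem exists_isBlowup_flat_lfp_of_forall_affineOpens_source {X S : Scheme.{u}} (f : X ⟶ S)
    [CompactSpace X] (U : S.Opens)
    (h : ∀ V : X.affineOpens, ∃ (I : S.IdealSheafData) (S' : Scheme.{u}) (b : S' ⟶ S),
      (∀ W : S.affineOpens, (I.ideal W).FG) ∧ Disjoint (U : Set S) (I.support : Set S) ∧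
      IsBlowup b I ∧ Flat (blowupStrictTransformMap ((V : X.Opens).ι ≫ f) b I) ∧
      LocallyOfFinitePresentation (blowupStrictTransformMap ((V : X.Opens).ι ≫ f) b I)) :
    ∃ (I : S.IdealSheafData) (S' : Scheme.{u}) (b : S' ⟶ S),
      (∀ W : S.affineOpens, (I.ideal W).FG) ∧ Disjoint (U : Set S) (I.support : Set S) ∧
      IsBlowup b I ∧ Flat (blowupStrictTransformMap f b I) ∧
      LocallyOfFinitePresentation (blowupStrictTransformMap f b I) := by
  classical
  obtain ⟨t, ht⟩ := exists_finset_affineOpens_iSup_eq_top X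
  have ht' : ⨆ V : t, (((V : X.affineOpens) : X.Opens)) = ⊤ :=
    top_le_iff.mp (ht.trans (le_of_eq iSup_subtype'))
  choose I S₁ b₁ hIfg hIU hb₁ hflat₁ hlfp₁ using h
  -- one `U`-admissible blowing up dominating the `b₁ V`, `V ∈ t` (Stacks 080N)
  obtain ⟨S', c, hc, hcfg, hcU, hdom⟩ :=
    IsBlowup.exists_isBlowup_prod_dominating U (fun V : t => b₁ V) (fun V : t => I V)
      (fun V => hb₁ V) (fun V => hIfg V) (fun V => hIU V)
  choose g hg _hgb _hgfg _hgU using hdom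
  have hsupp : ∀ V : t, ((I V).support : Set S) ⊆ ((∏ W : t, I W).support : Set S) := fun V x hx =>
    Scheme.IdealSheafData.support_antitone
      (finsetProd_le Finset.univ (fun W : t => I W) (Finset.mem_univ V)) hx
  have hE : IsEffectiveCartier ((∏ W : t, I W).comap c) := hc.isEffectiveCartier
  haveI : ∀ V : t, Flat (blowupStrictTransformMap (((V : X.affineOpens) : X.Opens).ι ≫ f) c
      (∏ W : t, I W)) := fun V =>
    haveI := hflat₁ V
    flat_blowupStrictTransformMap_of_dominating (Iᵢ := I V) (I := ∏ W : t, I W) (hg V) (hsupp V) hE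
  refine ⟨∏ V : t, I V, S', c, hcfg, hcU, hc, ?_, ?_⟩
  · exact blowupStrictTransformMap_of_iSup_eq_top f c (∏ V : t, I V) @Flat hE
      (fun V : t => ((V : X.affineOpens) : X.Opens)) ht' fun V => inferInstance
  · refine blowupStrictTransformMap_of_iSup_eq_top f c (∏ V : t, I V) @LocallyOfFinitePresentation
      hE (fun V : t => ((V : X.affineOpens) : X.Opens)) ht' fun V => ?_
    haveI := hflat₁ V
    haveI := hlfp₁ V
    exact locallyOfFinitePresentation_blowupStrictTransformMap_of_dominating (Iᵢ := I V)
      (I := ∏ W : t, I W) (hg V) (hsupp V) hE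

/-! ## `Stacks081R` from its affine cases -/

/-- **Raynaud–Gruson flattening (Stacks, Tag 081R) follows from its case of an affine base.**
If the statement of `Stacks081R` holds whenever the base `S` is moreover affine, then it holds:
for `T ⊆ S` affine, `X ×_S T → T` is again quasi-compact, locally of finite type and
quasi-separated, `U ∩ T` is quasi-compact (`S` being quasi-separated) and `X ×_S T → T` is flat
and locally of finite presentation over it (base change of `X_U → U`); conclude by
`exists_isBlowup_flat_lfp_of_forall_affineOpens_base`.
[cite: StacksProject, Tag 0814 with Tag 081R (proof)] -/
theorem stacks081R_of_isAffine_base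
    (h : ∀ ⦃X S : Scheme.{u}⦄ (f : X ⟶ S) [IsAffine S] [CompactSpace S] [QuasiSeparatedSpace S]
      [QuasiCompact f] [LocallyOfFiniteType f] [QuasiSeparated f] (U : S.Opens),
      IsCompact (U : Set S) → Flat (f ∣_ U) → LocallyOfFinitePresentation (f ∣_ U) →
      ∃ (I : S.IdealSheafData) (S' : Scheme.{u}) (b : S' ⟶ S),
        (∀ W : S.affineOpens, (I.ideal W).FG) ∧ Disjoint (U : Set S) (I.support : Set S) ∧
        IsBlowup b I ∧ Flat (blowupStrictTransformMap f b I) ∧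
        LocallyOfFinitePresentation (blowupStrictTransformMap f b I)) :
    Stacks081R.{u} := by
  intro X S f _ _ _ _ _ U hU hflat hlfp
  refine exists_isBlowup_flat_lfp_of_forall_affineOpens_base f U hU fun T => ?_
  haveI : IsAffine (T : Scheme.{u}) := T.2
  haveI : QuasiCompact (T : S.Opens).ι := quasiCompact_ι_of_isCompact _ T.2.isCompact
  have hUT : IsCompact ((((T : S.Opens).ι ⁻¹ᵁ U : (T : Scheme.{u}).Opens)) : Set T) :=
    (T : S.Opens).ι.isCompact_preimage hU
  have hflatT : Flat ((pullback.snd f (T : S.Opens).ι) ∣_ ((T : S.Opens).ι ⁻¹ᵁ U)) :=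
    pullback_snd_morphismRestrict_preimage @Flat f _ U hflat
  have hlfpT : LocallyOfFinitePresentation
      ((pullback.snd f (T : S.Opens).ι) ∣_ ((T : S.Opens).ι ⁻¹ᵁ U)) :=
    pullback_snd_morphismRestrict_preimage @LocallyOfFinitePresentation f _ U hlfp
  exact h (pullback.snd f (T : S.Opens).ι) ((T : S.Opens).ι ⁻¹ᵁ U) hUT hflatT hlfpT

/-- **Raynaud–Gruson flattening (Stacks, Tag 081R) follows from its case of an affine base and
an affine source** — the setting `S = Spec R`, `X = Spec A` (`A` an `R`-algebra of finite type)
of Raynaud–Gruson, Première partie, §5 / Stacks, Tag 0815: combine `stacks081R_of_isAffine_base`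
with the locality on the source (`exists_isBlowup_flat_lfp_of_forall_affineOpens_source`: the
affine opens `V ⊆ X` give `V → S` quasi-compact, locally of finite type, quasi-separated, flat
and locally of finite presentation over `U`).
[cite: StacksProject, Tag 081R (proof) with Tag 0814; RaynaudGruson1971, Première partie Thm. 5.2.2] -/
theorem stacks081R_of_isAffine_isAffine
    (h : ∀ ⦃X S : Scheme.{u}⦄ (f : X ⟶ S) [IsAffine X] [IsAffine S] [CompactSpace S]
      [QuasiSeparatedSpace S] [QuasiCompact f] [LocallyOfFiniteType f] [QuasiSeparated f]
      (U : S.Opens), IsCompact (U : Set S) → Flat (f ∣_ U) → LocallyOfFinitePresentation (f ∣_ U) →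
      ∃ (I : S.IdealSheafData) (S' : Scheme.{u}) (b : S' ⟶ S),
        (∀ W : S.affineOpens, (I.ideal W).FG) ∧ Disjoint (U : Set S) (I.support : Set S) ∧
        IsBlowup b I ∧ Flat (blowupStrictTransformMap f b I) ∧
        LocallyOfFinitePresentation (blowupStrictTransformMap f b I)) :
    Stacks081R.{u} := by
  refine stacks081R_of_isAffine_base fun X S f _ _ _ _ _ _ U hU hflat hlfp => ?_
  haveI : CompactSpace X := QuasiCompact.compactSpace_of_compactSpace f
  refine exists_isBlowup_flat_lfp_of_forall_affineOpens_source f U fun V => ?_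
  haveI : IsAffine (((V : X.affineOpens) : X.Opens) : Scheme.{u}) := V.2
  haveI := hflat
  haveI := hlfp
  haveI : Flat ((((V : X.affineOpens) : X.Opens).ι ≫ f) ∣_ U) := by
    rw [morphismRestrict_comp]
    show Flat ((((V : X.affineOpens) : X.Opens).ι ∣_ (f ⁻¹ᵁ U)) ≫ f ∣_ U)
    infer_instance
  haveI : LocallyOfFinitePresentation ((((V : X.affineOpens) : X.Opens).ι ≫ f) ∣_ U) := by
    rw [morphismRestrict_comp]
    show LocallyOfFinitePresentation ((((V : X.affineOpens) : X.Opens).ι ∣_ (f ⁻¹ᵁ U)) ≫ f ∣_ U)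
    infer_instance
  exact h _ U hU inferInstance inferInstance

end Literature.AlgebraicGeometry.Resolution

end
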